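import Mathlib
import Literature.MathematicalPhysics.QuantumLattice.WilsonDiracAP
import Summits.QuantumFields.QCD.Theorems.QuarksAsStableActionWilsonQuarkStabilityTangentDelta

/-!
# The Hessian margin from its sub-stubs: auxiliary lemmas
(auxiliary lemmas; helper for crux stmt-QuantumFields-9734, line `Sketch`, composition
`hessianMargin_of_stubs` of stub `stub_hessianMargin`)

What.  Small general facts used by the in-skeleton composition
`hessianMargin_of_stubs : MgW → MgK → MgM → MgN → P0 → P1 → P2 → P3 → Mg`:
* traces of squares of anti-Hermitian matrices are real, `Re tr (A A) = −‖A‖_F²`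
  (`re_trace_mul_self_of_conjTranspose`, `im_trace_mul_self_of_conjTranspose`);
* the abstract gauge invariance of a block Hessian `Q(Y) = ½𝔅(Y,Y) − ½ℓ(Y⋆Y)` built from an additive
  hopping map `Δ` and a propagator `S` (`𝔅(E₁,E₂) = Re tr (SΔE₁ SΔE₂)`, `ℓ(E) = Re tr (SΔE)`): the two
  polarised Ward identities `𝔅(Y − D, D) = ½ℓ((Y−D)⋆D + D⋆(Y−D))`, `𝔅(D,D) = ½ℓ(D⋆D + D⋆D)` give
  `Q(Y) = Q(Y − D)` (`hessian_gauge_invariance`; pure ring algebra and cyclicity of the trace);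
* the Bloch angles `π k/M + π/(2M)`, `k < M`, lie in `(0, π)` (`blochAngle_mem`);
* a Young-type bound for the mass-Lipschitz coefficient,
  `16/(x√y) + 16/(y√x) + 40/(√x√y) ≤ 36 (x^{-3/2} + y^{-3/2}) + 40` (`massCoeff_le`, `x^{-3/2} = √x/x²`);
* the final real bookkeeping of the composition (`bookkeeping`, registered as
  `stub_hessianMarginOfStubsAux`).

References: Montvay–Münster, *Quantum Fields on a Lattice* §4.2 (Wilson fermions, hopping expansion);
folklore linear algebra and real arithmetic.  Pure theorem file (no `def`s); pattern: sibling
`…StubOneLoopMarginOfAux`.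
-/

noncomputable section

open scoped BigOperators Classical Matrix ComplexConjugate
open Finset
open Literature.MathematicalPhysics.QuantumLattice Literature.MathematicalPhysics.QuantumFieldTheory
  Literature.Probability.LatticeModels

namespace Summit.QuantumFields.QCD.Cruxes.CriticalLineDiamagnetism.ChessboardCellGain

namespace HessianMarginOf

open Summit.QuantumFields.QCD.Cruxes.WilsonQuarkStability.FreeTangentLandauChessboard
  (sum_norm_sq_eq_re_trace_conjTranspose_mul_self)

/-! ### Traces of squares of anti-Hermitian matrices -/

/-- For anti-Hermitian `A`: `Re tr (A A) = −Σ_{ab} ‖A_{ab}‖²`. -/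
theorem re_trace_mul_self_of_conjTranspose {n : Type*} [Fintype n] (A : Matrix n n ℂ)
    (hA : Aᴴ = -A) : (A * A).trace.re = -∑ a, ∑ b, ‖A a b‖ ^ 2 := by
  rw [sum_norm_sq_eq_re_trace_conjTranspose_mul_self, hA, Matrix.neg_mul, Matrix.trace_neg,
    Complex.neg_re, neg_neg]

/-- For anti-Hermitian `A`: `tr (A A)` is real. -/
theorem im_trace_mul_self_of_conjTranspose {n : Type*} [Fintype n] (A : Matrix n n ℂ)
    (hA : Aᴴ = -A) : (A * A).trace.im = 0 := by
  have h : star (A * A).trace = (A * A).trace := by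
    rw [← Matrix.trace_conjTranspose, Matrix.conjTranspose_mul, hA, neg_mul_neg]
  exact Complex.conj_eq_iff_im.1 h

/-! ### Gauge invariance of an abstract block Hessian from the polarised Ward identities -/

/-- **Gauge modes lie in the kernel of the block Hessian.**  For an additive hopping map `Δ` on link
fields and any matrix `S`, with `𝔅(E₁,E₂) = Re tr (SΔE₁ SΔE₂)`, `ℓ(E) = Re tr (SΔE)`,
`Q(E) = ½𝔅(E,E) − ½ℓ(E⋆E)`: the Ward identities `𝔅(Y−D, D) = ½ℓ((Y−D)⋆D + D⋆(Y−D))` and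
`𝔅(D, D) = ½ℓ(D⋆D + D⋆D)` imply `Q(Y) = Q(Y − D)` (bilinearity, symmetry of `𝔅` by cyclicity). -/
theorem hessian_gauge_invariance {ι L n : Type*} [Fintype ι] [Fintype n] (S : Matrix ι ι ℂ)
    (Dl : (L → Matrix n n ℂ) → Matrix ι ι ℂ) (hadd : ∀ E₁ E₂, Dl (E₁ + E₂) = Dl E₁ + Dl E₂)
    (Y D : L → Matrix n n ℂ)
    (hW1 : (S * Dl (fun e => Y e - D e) * (S * Dl D)).trace.re =
      (S * Dl (fun e => (Y e - D e) * D e + D e * (Y e - D e))).trace.re / 2)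
    (hW2 : (S * Dl D * (S * Dl D)).trace.re =
      (S * Dl (fun e => D e * D e + D e * D e)).trace.re / 2) :
    (S * Dl Y * (S * Dl Y)).trace.re / 2 - (S * Dl (fun e => Y e * Y e)).trace.re / 2 =
      (S * Dl (fun e => Y e - D e) * (S * Dl (fun e => Y e - D e))).trace.re / 2 -
        (S * Dl (fun e => (Y e - D e) * (Y e - D e))).trace.re / 2 := by
  set A : L → Matrix n n ℂ := fun e => Y e - D e with hA
  have hY : Y = A + D := by
    funext e
    simp only [hA, Pi.add_apply, sub_add_cancel]
  have hAe : ∀ e, A e = Y e - D e := fun e => rfl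
  simp only [← hAe] at hW1 ⊢
  -- `Δ Y = Δ A + Δ D`, `Y ⋆ Y = A ⋆ A + (A ⋆ D + D ⋆ A) + D ⋆ D`
  have hDY : S * Dl Y = S * Dl A + S * Dl D := by rw [hY, hadd, Matrix.mul_add]
  have hYY : (fun e => Y e * Y e) =
      (fun e => A e * A e) + ((fun e => A e * D e + D e * A e) + fun e => D e * D e) := by
    funext e
    simp only [hY, Pi.add_apply, Matrix.add_mul, Matrix.mul_add]
    abel
  have hDD : (fun e => D e * D e + D e * D e) = (fun e => D e * D e) + fun e => D e * D e := by
    funext e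
    simp only [Pi.add_apply]
  rw [hDD, hadd, Matrix.mul_add, Matrix.trace_add, Complex.add_re] at hW2
  have hsym : (S * Dl D * (S * Dl A)).trace = (S * Dl A * (S * Dl D)).trace :=
    Matrix.trace_mul_comm _ _
  have hb : (S * Dl Y * (S * Dl Y)).trace.re = (S * Dl A * (S * Dl A)).trace.re +
      2 * (S * Dl A * (S * Dl D)).trace.re + (S * Dl D * (S * Dl D)).trace.re := by
    rw [hDY, Matrix.add_mul, Matrix.mul_add, Matrix.mul_add, Matrix.trace_add, Matrix.trace_add,
      Matrix.trace_add, hsym, Complex.add_re, Complex.add_re, Complex.add_re]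
    ring
  have hl : (S * Dl (fun e => Y e * Y e)).trace.re = (S * Dl (fun e => A e * A e)).trace.re +
      (S * Dl (fun e => A e * D e + D e * A e)).trace.re + (S * Dl (fun e => D e * D e)).trace.re := by
    rw [hYY, hadd, hadd, Matrix.mul_add, Matrix.mul_add, Matrix.trace_add, Matrix.trace_add,
      Complex.add_re, Complex.add_re]
    ring
  rw [hb, hl]
  linarith

/-! ### The Bloch angles -/

/-- The Bloch angle `π k/M + π/(2M) = (2k+1)π/(2M)` lies in `(0, π)` for `k < M`. -/
theorem blochAngle_mem {M k : ℕ} (hk : k < M) :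
    0 < Real.pi * (k : ℝ) / M + Real.pi / (2 * M) ∧
      Real.pi * (k : ℝ) / M + Real.pi / (2 * M) < Real.pi := by
  -- adapted from `CellGainCore.sin_sq_pos`
  have hM : (0 : ℝ) < M := by exact_mod_cast (Nat.zero_le k).trans_lt hk
  have h2 : (2 * k + 1 : ℝ) < 2 * M := by exact_mod_cast (by omega : 2 * k + 1 < 2 * M)
  have hx : Real.pi * (k : ℝ) / M + Real.pi / (2 * M) = Real.pi * ((2 * k + 1) / (2 * M)) := by
    field_simp
  have hlt : (2 * k + 1 : ℝ) / (2 * M) < 1 := (div_lt_one (by positivity)).2 h2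
  rw [hx]
  exact ⟨by positivity, by nlinarith [Real.pi_pos]⟩

/-! ### Real arithmetic -/

/-- **Young-type bound for the mass-Lipschitz coefficient.**  For `x, y > 0`:
`16/(x√y) + 16/(y√x) + 40/(√x√y) ≤ 36 (√x/x² + √y/y²) + 40`
(`a²b + ab² ≤ a³ + b³`, `2ab ≤ a² + b²`, `a² ≤ a³ + 1` with `a = x^{-1/2}`, `b = y^{-1/2}`). -/
theorem massCoeff_le {x y : ℝ} (hx : 0 < x) (hy : 0 < y) :
    16 / (x * Real.sqrt y) + 16 / (y * Real.sqrt x) + 40 / (Real.sqrt x * Real.sqrt y) ≤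
      36 * (Real.sqrt x / x ^ 2 + Real.sqrt y / y ^ 2) + 40 := by
  obtain ⟨a, ha, rfl⟩ : ∃ a, 0 < a ∧ x = (a ^ 2)⁻¹ :=
    ⟨(Real.sqrt x)⁻¹, by positivity, by rw [inv_pow, Real.sq_sqrt hx.le, inv_inv]⟩
  obtain ⟨b, hb, rfl⟩ : ∃ b, 0 < b ∧ y = (b ^ 2)⁻¹ :=
    ⟨(Real.sqrt y)⁻¹, by positivity, by rw [inv_pow, Real.sq_sqrt hy.le, inv_inv]⟩
  have hsa : Real.sqrt (a ^ 2)⁻¹ = a⁻¹ := by rw [Real.sqrt_inv, Real.sqrt_sq ha.le]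
  have hsb : Real.sqrt (b ^ 2)⁻¹ = b⁻¹ := by rw [Real.sqrt_inv, Real.sqrt_sq hb.le]
  rw [hsa, hsb]
  have ha' : a ≠ 0 := ha.ne'
  have hb' : b ≠ 0 := hb.ne'
  have e1 : 16 / ((a ^ 2)⁻¹ * b⁻¹) = 16 * (a ^ 2 * b) := by rw [← mul_inv, div_inv_eq_mul]
  have e2 : 16 / ((b ^ 2)⁻¹ * a⁻¹) = 16 * (b ^ 2 * a) := by rw [← mul_inv, div_inv_eq_mul]
  have e3 : 40 / (a⁻¹ * b⁻¹) = 40 * (a * b) := by rw [← mul_inv, div_inv_eq_mul]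
  have e4 : a⁻¹ / ((a ^ 2)⁻¹) ^ 2 = a ^ 3 := by field_simp
  have e5 : b⁻¹ / ((b ^ 2)⁻¹) ^ 2 = b ^ 3 := by field_simp
  rw [e1, e2, e3, e4, e5]
  nlinarith [mul_nonneg (add_pos ha hb).le (sq_nonneg (a - b)), sq_nonneg (a - b),
    mul_nonneg ha.le (sq_nonneg (a - 1)), mul_nonneg hb.le (sq_nonneg (b - 1)),
    sq_nonneg (a - 1 / 2), sq_nonneg (b - 1 / 2)]

/-- **The real bookkeeping of the composition.**  Per block `k`: the Hessian at mass `m` is within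
`|m| β_k ‖Y′‖²` of the Hessian at mass `0`, which is `≥ g_k 𝒦`; `β_k ≤ 36 (t_m(k) + t_0(k)) + 40` with
`Σ t ≤ C M⁴`; `8‖Y′‖² ≤ 𝒦`; the region counts give `Σ_k g_k ≥ (617/2000000) M⁴`; the mass slack
`|m| (9 max C 0 + 5) ≤ 1/5000` then leaves `(1/10000) M⁴ 𝒦 ≤ Σ_k Q_k`. -/
theorem bookkeeping {K : Type*} [Fintype K] {Qm Q0 g β tm t0 : K → ℝ}
    {m nY 𝒦 C M4 N0 N1 N2 N3 : ℝ}
    (hmass : ∀ k, |Qm k - Q0 k| ≤ |m| * β k * nY) (hP : ∀ k, g k * 𝒦 ≤ Q0 k)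
    (hβ : ∀ k, β k ≤ 36 * (tm k + t0 k) + 40) (htm : ∑ k, tm k ≤ C * M4)
    (ht0 : ∑ k, t0 k ≤ C * M4) (hcard : ∑ _k : K, (1 : ℝ) = M4) (hnY : 8 * nY ≤ 𝒦)
    (hnY0 : 0 ≤ nY)
    (hg : ∑ k, g k = 3 / 2500 * N0 + 13 / 20000 * N1 - 1 / 4000 * N2 - 1 / 1000 * N3)
    (hN0 : 1 / 5 * M4 ≤ N0) (hN1 : 39 / 100 * M4 ≤ N1) (hN2 : N2 ≤ 3 / 10 * M4)
    (hN3 : N3 ≤ 11 / 100 * M4) (hm : |m| * (9 * max C 0 + 5) ≤ 1 / 5000) (hM4 : 0 ≤ M4) :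
    1 / 10000 * M4 * 𝒦 ≤ ∑ k, Qm k := by
  have h𝒦 : 0 ≤ 𝒦 := by linarith
  have hm0 : 0 ≤ |m| := abs_nonneg m
  -- per block
  have h1 : ∀ k, g k * 𝒦 - |m| * nY * (36 * (tm k + t0 k) + 40) ≤ Qm k := fun k => by
    have hβ' : |m| * β k * nY ≤ |m| * (36 * (tm k + t0 k) + 40) * nY :=
      mul_le_mul_of_nonneg_right (mul_le_mul_of_nonneg_left (hβ k) hm0) hnY0
    have := (abs_le.1 ((hmass k).trans hβ')).1
    have := hP k
    linarith
  have h2 : ∑ k, (g k * 𝒦 - |m| * nY * (36 * (tm k + t0 k) + 40)) ≤ ∑ k, Qm k :=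
    Finset.sum_le_sum fun k _ => h1 k
  have h3 : ∑ k, (g k * 𝒦 - |m| * nY * (36 * (tm k + t0 k) + 40)) =
      (∑ k, g k) * 𝒦 - |m| * nY * (36 * (∑ k, tm k + ∑ k, t0 k) + 40 * M4) := by
    rw [← hcard, Finset.sum_sub_distrib, Finset.sum_mul]
    congr 1
    rw [← Finset.sum_add_distrib, Finset.mul_sum _ _ (36 : ℝ), Finset.mul_sum _ _ (40 : ℝ),
      ← Finset.sum_add_distrib, Finset.mul_sum, mul_one]
  rw [h3, hg] at h2
  -- the lattice sums
  have hC : C ≤ max C 0 := le_max_left _ _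
  have hC0 : 0 ≤ max C 0 := le_max_right _ _
  have h4 : 36 * (∑ k, tm k + ∑ k, t0 k) + 40 * M4 ≤ (72 * max C 0 + 40) * M4 := by
    nlinarith [mul_le_mul_of_nonneg_right hC hM4]
  have h5 : |m| * nY * (36 * (∑ k, tm k + ∑ k, t0 k) + 40 * M4) ≤
      |m| * nY * ((72 * max C 0 + 40) * M4) :=
    mul_le_mul_of_nonneg_left h4 (mul_nonneg hm0 hnY0)
  have h6 : |m| * nY * ((72 * max C 0 + 40) * M4) = 8 * (|m| * (9 * max C 0 + 5)) * (nY * M4) := by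
    ring
  have h7 : 8 * (|m| * (9 * max C 0 + 5)) * (nY * M4) ≤ 8 * (1 / 5000) * (nY * M4) :=
    mul_le_mul_of_nonneg_right (mul_le_mul_of_nonneg_left hm (by norm_num))
      (mul_nonneg hnY0 hM4)
  have h8 : 8 * (1 / 5000) * (nY * M4) ≤ 1 / 5000 * (𝒦 * M4) := by nlinarith
  -- the region counts
  have h9 : 617 / 2000000 * M4 ≤ 3 / 2500 * N0 + 13 / 20000 * N1 - 1 / 4000 * N2 - 1 / 1000 * N3 := by
    linarith
  have h10 : 617 / 2000000 * M4 * 𝒦 ≤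
      (3 / 2500 * N0 + 13 / 20000 * N1 - 1 / 4000 * N2 - 1 / 1000 * N3) * 𝒦 :=
    mul_le_mul_of_nonneg_right h9 h𝒦
  nlinarith [mul_nonneg hM4 h𝒦]

end HessianMarginOf

/-- **Registered sub-goal of this auxiliary file** (`stub_hessianMarginOfStubsAux`, the real bookkeeping
`HessianMarginOf.bookkeeping` of the composition `hessianMargin_of_stubs`): per block `k` the Hessian
at mass `m` is within `|m| β_k ‖Y′‖²` of the Hessian at mass `0`, which is `≥ g_k 𝒦`;
`β_k ≤ 36 (t_m(k) + t_0(k)) + 40`, `Σ t ≤ C M⁴`, `8‖Y′‖² ≤ 𝒦`, the region counts and the mass slack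
`|m| (9 max C 0 + 5) ≤ 1/5000` give `(1/10000) M⁴ 𝒦 ≤ Σ_k Q_k`. -/
theorem stub_hessianMarginOfStubsAux : ∀ (M : ℕ) (Qm Q0 g β tm t0 : (Fin 4 → Fin M) → ℝ) (m nY 𝒦 C M4 N0 N1 N2 N3 : ℝ), (∀ k, |Qm k - Q0 k| ≤ |m| * β k * nY) → (∀ k, g k * 𝒦 ≤ Q0 k) → (∀ k, β k ≤ 36 * (tm k + t0 k) + 40) → ∑ k, tm k ≤ C * M4 → ∑ k, t0 k ≤ C * M4 → ∑ _k : Fin 4 → Fin M, (1 : ℝ) = M4 → 8 * nY ≤ 𝒦 → 0 ≤ nY → ∑ k, g k = 3 / 2500 * N0 + 13 / 20000 * N1 - 1 / 4000 * N2 - 1 / 1000 * N3 → 1 / 5 * M4 ≤ N0 → 39 / 100 * M4 ≤ N1 → N2 ≤ 3 / 10 * M4 → N3 ≤ 11 / 100 * M4 → |m| * (9 * max C 0 + 5) ≤ 1 / 5000 → 0 ≤ M4 → 1 / 10000 * M4 * 𝒦 ≤ ∑ k, Qm k :=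
  fun _ _ _ _ _ _ _ _ _ _ _ _ _ _ _ _ => HessianMarginOf.bookkeeping

end Summit.QuantumFields.QCD.Cruxes.CriticalLineDiamagnetism.ChessboardCellGain

end
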